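import Summits.PneNP.PneNP.Theses.OneSlice
import Literature.Computability.Complexity.ACRealize
import Literature.Computability.Complexity.ACRealizeConnectives
import Literature.Computability.Complexity.ACRealizeOver

/-!
# Negative lemmas for crux `SliceACZero` (stmt-PneNP-2835), Part VII: the lines' C⁺ `SliceIndist`

The two influence lines for the crux (`Cruxes/SliceACZero/Lines/russo-window-ladder.lean`, picked by the
lead, C⁺ `SliceIndist`; `Lines/binomial-hybrid-influence-budget.lean`, registered skeleton, C⁺ `sliceGap`)
prove slice/product indistinguishability for SMALL, BOUNDED-DEPTH `acBasis` circuits at the matched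
density `q = j/N`, for `j ≥ j₀` and `2j ≤ N`:
`|E_{μ_{j/N}}[C] − a_j(C)| ≤ ε` (rate `polylog(size)/√j`).  This file (with its companion) certifies that each of
the three structural hypotheses of that C⁺ is load-bearing, by refuting the variant that drops it
(the variants are DISPLAYED inline in the theorem statements; they are named `SliceIndistNearTop`,
`SliceIndistNoSize`, `SliceIndistNoDepth` only in the work file `Cruxes/SliceACZero/Disproof.lean`):

* `not_sliceIndistNearTop` — `2j ≤ N` weakened to `j < N` is FALSE for every depth `d ≥ 1` and size
  exponent `c`: one `∧`-gate over all `N = j+1` inputs at the slice `j = N − 1` (`a_j = 0`,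
  `E_μ = (1 − 1/N)^N ≥ 1/6`).  The honest hypothesis is `min(j, N−j) → ∞`.
* `not_sliceIndistNoSize` — dropping `C.size ≤ j^c` is FALSE for every `d ≥ 2`: the exact-weight DNF
  `[|x| = j]` at `N = 2j` (`a_j = 1`, `E_μ = C(2j,j)/4^j ≤ 1/2`).
* (companion file `SliceIndistParity.lean`) `not_sliceIndistNoDepth` — dropping `C.acDepth ≤ d` is
  FALSE for every `c ≥ 2`: PARITY as a chain of XORs (`≤ 5N+1` gates) at `N = 2j`, `j` even.

Vocabulary (`wt`, `prodWeight`, `prodAvg`, `sliceAvg`) is copied verbatim from the russo line so that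
each variant differs from `SliceIndist` in exactly one clause; circuits are built with the tree's
`ACReal` toolkit (`ACRealize*.lean`).  Nothing here asserts a Theses decl positively; everything is
sorry-free with standard axioms.  Source: the disprover's work file `Cruxes/SliceACZero/Disproof.lean`
(Part VII), refuter-cdisprove-stmt-PneNP-2835-g2-0, 2026-08-16.
-/

noncomputable section

namespace Summit.PneNP.PneNP.Theorems.SliceACZero.Negative

open Literature.Computability.Complexity Filter Finset

/-! ### Vocabulary on a finite cube (verbatim copy of `Lines/russo-window-ladder.lean` §Vocabulary) -/

section Cube

variable {ι : Type} [Fintype ι] [DecidableEq ι]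

/-- `|x|`: the number of ones of `x` (verbatim copy of the russo-window-ladder vocabulary). [folklore] -/
def wt (x : ι → Bool) : ℕ := #(univ.filter fun i => x i = true)

/-- The `μ_q` weight `q^{|x|}(1−q)^{N−|x|}` (verbatim copy). [folklore] -/
def prodWeight (q : ℝ) (x : ι → Bool) : ℝ := q ^ wt x * (1 - q) ^ (Fintype.card ι - wt x)

/-- `E_{μ_q}[f]` as a finite sum (verbatim copy). [folklore] -/
def prodAvg (q : ℝ) (f : (ι → Bool) → Bool) : ℝ :=
  ∑ x ∈ univ.filter (fun x : ι → Bool => f x = true), prodWeight q x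

/-- `a_ℓ(f)`: the fraction of the Hamming slice `{|x| = ℓ}` on which `f = 1` (verbatim copy). [folklore] -/
def sliceAvg (f : (ι → Bool) → Bool) (ℓ : ℕ) : ℝ :=
  (#(univ.filter fun x : ι → Bool => wt x = ℓ ∧ f x = true) : ℝ) /
    (#(univ.filter fun x : ι → Bool => wt x = ℓ) : ℝ)

omit [DecidableEq ι] in
/-- The all-ones point has weight `N`. [folklore] -/
theorem wt_const_true : wt (fun _ : ι => true) = Fintype.card ι := by
  simp [wt]

omit [DecidableEq ι] in
/-- `|x| ≤ N`. [folklore] -/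
theorem wt_le_card (x : ι → Bool) : wt x ≤ Fintype.card ι := by
  unfold wt
  exact (Finset.card_filter_le _ _).trans (by rw [Finset.card_univ])

/-- The number of points of weight `j` on `{0,1}^ι` is `C(N,j)`. [folklore] -/
theorem card_filter_wt_eq (j : ℕ) :
    #(univ.filter fun x : ι → Bool => wt x = j) = (Fintype.card ι).choose j := by
  rw [← Finset.card_univ (α := ι), ← Finset.card_powersetCard]
  refine Finset.card_nbij' (fun x => univ.filter fun i => x i = true) (fun S i => decide (i ∈ S))
    ?_ ?_ ?_ ?_
  · intro x hx
    rw [Finset.mem_coe, Finset.mem_filter] at hx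
    rw [Finset.mem_coe, Finset.mem_powersetCard]
    exact ⟨Finset.filter_subset _ _, hx.2⟩
  · intro S hS
    rw [Finset.mem_coe, Finset.mem_powersetCard] at hS
    rw [Finset.mem_coe, Finset.mem_filter]
    refine ⟨Finset.mem_univ _, ?_⟩
    unfold wt
    have : (univ.filter fun i : ι => decide (i ∈ S) = true) = S := by
      ext i
      simp
    rw [this]
    exact hS.2
  · intro x _
    funext i
    simp
  · intro S _
    ext i
    simp

end Cube

/-! ### Variant A is false: one `∧`-gate at the slice `j = N − 1` -/

/-- **One unbounded fan-in `∧`-gate reading every input**: size `≤ 1`, `acDepth ≤ 1`, over `acBasis`,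
computing `x ↦ [∀ i, x i]`. [folklore] -/
theorem exists_andAll_circuit (ι : Type) [Fintype ι] :
    ∃ C : Circuit ι, C.IsOver acBasis ∧ C.acDepth ≤ 1 ∧ C.size ≤ 1 ∧
      ∀ x, C.eval x = true ↔ ∀ i, x i = true := by
  have h : ACReal (fun x : ι → Bool => decide (∀ k : ι, (fun (k : ι) (y : ι → Bool) => y k) k x = true))
      (0 + 1) (Fintype.card ι * 0 + 1) :=
    acReal_forall_fintype (f := fun (k : ι) (y : ι → Bool) => y k) fun k => acReal_input k
  obtain ⟨C, hB, hd, hs, he⟩ := h.toCircuit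
  refine ⟨C, hB, by simpa using hd, by simpa using hs, fun x => ?_⟩
  rw [he]
  exact decide_eq_true_iff

/-- `(j/(j+1))^{j+1} ≥ 1/6` for `j ≥ 1` (from `1 + 1/j ≤ e^{1/j}` and `e < 3`). [folklore] -/
theorem sixth_le {j : ℕ} (hj : 1 ≤ j) : (1 : ℝ) / 6 ≤ ((j : ℝ) / (j + 1)) ^ (j + 1) := by
  have hj0 : (0 : ℝ) < j := by exact_mod_cast hj
  have h1 : (1 + 1 / (j : ℝ)) ^ j ≤ 3 := by
    have hexp := Real.add_one_le_exp (1 / (j : ℝ))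
    calc (1 + 1 / (j : ℝ)) ^ j ≤ (Real.exp (1 / (j : ℝ))) ^ j := by
          exact pow_le_pow_left₀ (by positivity) (by linarith) j
      _ = Real.exp 1 := by
          rw [← Real.exp_nat_mul]
          congr 1
          field_simp
      _ ≤ 3 := by
          have := Real.exp_one_lt_d9
          linarith
  have h3 : (1 + 1 / (j : ℝ)) ≤ 2 := by
    have : 1 / (j : ℝ) ≤ 1 := by
      rw [div_le_one hj0]
      exact_mod_cast hj
    linarith
  have h2 : (1 + 1 / (j : ℝ)) ^ (j + 1) ≤ 6 := by
    rw [pow_succ]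
    calc (1 + 1 / (j : ℝ)) ^ j * (1 + 1 / (j : ℝ)) ≤ 3 * 2 :=
          mul_le_mul h1 h3 (by positivity) (by norm_num)
      _ = 6 := by norm_num
  have h4 : ((j : ℝ) / (j + 1)) * (1 + 1 / (j : ℝ)) = 1 := by
    field_simp
  have h5 : ((j : ℝ) / (j + 1)) ^ (j + 1) * (1 + 1 / (j : ℝ)) ^ (j + 1) = 1 := by
    rw [← mul_pow, h4, one_pow]
  have h6 : 0 < (1 + 1 / (j : ℝ)) ^ (j + 1) := by positivity
  rw [eq_one_div_of_mul_eq_one_left h5]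
  exact one_div_le_one_div_of_le h6 h2

/-- **Variant A of the lines' C⁺ is FALSE** — `SliceIndist` with the headroom `2j ≤ N` weakened to
`j < N`, at any depth `d ≥ 1` and size exponent `c` (the displayed statement). Witness: `ι = Fin (j+1)`, the slice `j = N − 1`, and the single
`∧`-gate `C = ⋀ᵢ xᵢ` (size `1 ≤ j^c`, `acDepth 1`): `a_j(C) = 0` (no point of weight `N−1` is
all-ones) while `E_{μ_{j/N}}[C] = (1 − 1/N)^N ≥ 1/6`. So the headroom `2j ≤ N` in `SliceIndist` is
load-bearing; by the ones/zeros symmetry of the cube the true condition is `min(j, N − j) → ∞`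
(rate `polylog / √min(j, N−j)`), of which `2j ≤ N` plus `j ≥ j₀` is the half used by the crux
(`j ≈ m_k(n) ≪ C(n,2)`). [folklore] -/
theorem not_sliceIndistNearTop {d : ℕ} (hd1 : 1 ≤ d) (c : ℕ) :
    ¬ (∀ ε : ℝ, 0 < ε → ∃ j₀ : ℕ, ∀ (ι : Type) [Fintype ι] [DecidableEq ι] (j : ℕ),
        j₀ ≤ j → j < Fintype.card ι →
          ∀ C : Circuit ι, C.IsOver acBasis → C.acDepth ≤ d → C.size ≤ j ^ c →
            |prodAvg ((j : ℝ) / (Fintype.card ι : ℝ)) C.eval - sliceAvg C.eval j| ≤ ε) := by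
  intro h
  obtain ⟨j₀, hj₀⟩ := h (1 / 10) (by norm_num)
  set j : ℕ := max j₀ 1 with hj
  have hj1 : 1 ≤ j := le_max_right _ _
  obtain ⟨C, hB, hd, hs, he⟩ := exists_andAll_circuit (Fin (j + 1))
  have hsz : C.size ≤ j ^ c := hs.trans (Nat.one_le_pow c j hj1)
  have key := hj₀ (Fin (j + 1)) j (le_max_left _ _) (by simp) C hB (hd.trans hd1) hsz
  have hslice : sliceAvg C.eval j = 0 := by
    unfold sliceAvg
    rw [Finset.card_eq_zero.2, Nat.cast_zero, zero_div]
    rw [Finset.filter_eq_empty_iff]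
    rintro x - ⟨hw, hx⟩
    have hall : ∀ i, x i = true := (he x).1 hx
    have hx' : x = fun _ => true := funext hall
    rw [hx', wt_const_true, Fintype.card_fin] at hw
    omega
  have hprod : prodAvg ((j : ℝ) / (Fintype.card (Fin (j + 1)) : ℝ)) C.eval =
      ((j : ℝ) / (j + 1)) ^ (j + 1) := by
    unfold prodAvg
    have hfilter : (univ.filter fun x : Fin (j + 1) → Bool => C.eval x = true) = {fun _ => true} := by
      ext x
      simp only [Finset.mem_filter, Finset.mem_univ, true_and, Finset.mem_singleton, he]
      constructor
      · intro hx
        funext i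
        exact hx i
      · rintro rfl i
        rfl
    rw [hfilter, Finset.sum_singleton]
    unfold prodWeight
    rw [wt_const_true, Fintype.card_fin, Nat.sub_self, pow_zero, mul_one]
    push_cast
    ring
  rw [hslice, hprod, sub_zero] at key
  have hlow : (1 : ℝ) / 6 ≤ ((j : ℝ) / (j + 1)) ^ (j + 1) := sixth_le hj1
  rw [abs_of_nonneg (by positivity)] at key
  linarith

/-! ### Variant B is false: the exact-weight indicator `[|x| = j]` (depth 2) at `N = 2j` -/

/-- **The exact-weight indicator as a depth-2 circuit**: `⋁_{|S| = j} ⋀ᵢ [xᵢ = 1_S(i)]`, over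
`acBasis`, `acDepth ≤ 2` (negations are free), computing `x ↦ [|x| = j]` (size `C(N,j)·(N+1)+1`,
irrelevant here). [folklore] -/
theorem exists_exactWeight_circuit (ι : Type) [Fintype ι] [DecidableEq ι] (j : ℕ) :
    ∃ C : Circuit ι, C.IsOver acBasis ∧ C.acDepth ≤ 2 ∧ ∀ x, C.eval x = true ↔ wt x = j := by
  have hin : ∀ S : {S : Finset ι // #S = j},
      ACReal (fun x : ι → Bool => decide (∀ i : ι,
        (fun (i : ι) (y : ι → Bool) => decide (y i = decide (i ∈ S.1))) i x = true))
        (0 + 1) (Fintype.card ι * 1 + 1) :=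
    fun S => acReal_forall_fintype fun i => acReal_lit i (decide (i ∈ S.1))
  have hout := acReal_exists_fintype hin
  obtain ⟨C, hB, hd, -, he⟩ := hout.toCircuit
  refine ⟨C, hB, hd, fun x => ?_⟩
  rw [he, decide_eq_true_iff]
  simp only [decide_eq_true_eq]
  constructor
  · rintro ⟨S, hS⟩
    unfold wt
    have : (univ.filter fun i : ι => x i = true) = S.1 := by
      ext i
      simp only [Finset.mem_filter, Finset.mem_univ, true_and]
      rw [hS i]
      simp
    rw [this]
    exact S.2
  · intro hw
    refine ⟨⟨univ.filter fun i : ι => x i = true, hw⟩, fun i => ?_⟩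
    simp

/-- `2·C(2j, j) ≤ 4^j` for `j ≥ 1` (the central binomial coefficient is at most half of the row
sum; from `Nat.sum_range_choose_halfway` and `Nat.choose_symm_half`). [folklore] -/
theorem two_mul_centralBinom_le {j : ℕ} (hj : 1 ≤ j) : 2 * (2 * j).choose j ≤ 4 ^ j := by
  obtain ⟨m, rfl⟩ : ∃ m, j = m + 1 := ⟨j - 1, by omega⟩
  have hsum := Nat.sum_range_choose_halfway m
  have hle : (2 * m + 1).choose m ≤ 4 ^ m := by
    rw [← hsum]
    exact Finset.single_le_sum (f := fun i => (2 * m + 1).choose i) (fun _ _ => Nat.zero_le _)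
      (Finset.mem_range.2 (Nat.lt_succ_self m))
  have hrec : (2 * (m + 1)).choose (m + 1) = (2 * m + 1).choose m + (2 * m + 1).choose (m + 1) := by
    rw [show 2 * (m + 1) = (2 * m + 1) + 1 by ring, Nat.choose_succ_succ']
  rw [hrec, Nat.choose_symm_half, pow_succ]
  omega

/-- **Variant B of the lines' C⁺ is FALSE** — `SliceIndist` with the size bound `C.size ≤ j^c`
dropped, at any depth `d ≥ 2` (the displayed statement). Witness: `ι = Fin (2j)`, the middle slice, and the depth-2 exact-weight
circuit `C = [|x| = j]`: `a_j(C) = 1` while `E_{μ_{1/2}}[C] = C(2j,j)/4^j ≤ 1/2`. So the size bound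
in `SliceIndist` is load-bearing (any `polylog(size)/√j` rate is killed by size `≈ C(N,j)`): the
slice is NOT fooled by depth-2 circuits in general, only by SMALL ones. [folklore] -/
theorem not_sliceIndistNoSize {d : ℕ} (hd2 : 2 ≤ d) :
    ¬ (∀ ε : ℝ, 0 < ε → ∃ j₀ : ℕ, ∀ (ι : Type) [Fintype ι] [DecidableEq ι] (j : ℕ),
        j₀ ≤ j → 2 * j ≤ Fintype.card ι →
          ∀ C : Circuit ι, C.IsOver acBasis → C.acDepth ≤ d →
            |prodAvg ((j : ℝ) / (Fintype.card ι : ℝ)) C.eval - sliceAvg C.eval j| ≤ ε) := by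
  intro h
  obtain ⟨j₀, hj₀⟩ := h (1 / 4) (by norm_num)
  set j : ℕ := max j₀ 1 with hj
  have hj1 : 1 ≤ j := le_max_right _ _
  obtain ⟨C, hB, hd, he⟩ := exists_exactWeight_circuit (Fin (2 * j)) j
  have key := hj₀ (Fin (2 * j)) j (le_max_left _ _) (by simp) C hB (hd.trans hd2)
  have hcardj : #(univ.filter fun x : Fin (2 * j) → Bool => wt x = j) = (2 * j).choose j := by
    rw [card_filter_wt_eq, Fintype.card_fin]
  have hfilter : (univ.filter fun x : Fin (2 * j) → Bool => C.eval x = true) =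
      univ.filter fun x : Fin (2 * j) → Bool => wt x = j := by
    ext x
    simp [he]
  have hslice : sliceAvg C.eval j = 1 := by
    unfold sliceAvg
    have hnum : (univ.filter fun x : Fin (2 * j) → Bool => wt x = j ∧ C.eval x = true) =
        univ.filter fun x : Fin (2 * j) → Bool => wt x = j := by
      ext x
      simp [he]
    rw [hnum, hcardj]
    have hpos : (0 : ℝ) < ((2 * j).choose j : ℕ) := by exact_mod_cast Nat.choose_pos (by omega)
    exact div_self hpos.ne'
  have hq : (j : ℝ) / (Fintype.card (Fin (2 * j)) : ℝ) = 1 / 2 := by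
    rw [Fintype.card_fin]
    have hj0 : (0 : ℝ) < j := by exact_mod_cast hj1
    push_cast
    field_simp
  have hprod : prodAvg ((j : ℝ) / (Fintype.card (Fin (2 * j)) : ℝ)) C.eval ≤ 1 / 2 := by
    rw [hq]
    unfold prodAvg
    rw [hfilter]
    have hterm : ∀ x ∈ (univ.filter fun x : Fin (2 * j) → Bool => wt x = j),
        prodWeight (1 / 2 : ℝ) x = (1 / 4 : ℝ) ^ j := by
      intro x hx
      rw [Finset.mem_filter] at hx
      unfold prodWeight
      rw [hx.2, Fintype.card_fin, show 2 * j - j = j by omega, ← mul_pow]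
      norm_num
    rw [Finset.sum_congr rfl hterm, Finset.sum_const, hcardj, nsmul_eq_mul]
    have hcb : (2 : ℝ) * ((2 * j).choose j : ℕ) ≤ (4 : ℝ) ^ j := by
      exact_mod_cast two_mul_centralBinom_le hj1
    have h4 : (0 : ℝ) < (4 : ℝ) ^ j := by positivity
    have : (((2 * j).choose j : ℕ) : ℝ) * (1 / 4 : ℝ) ^ j = (((2 * j).choose j : ℕ) : ℝ) / 4 ^ j := by
      rw [one_div_pow, mul_one_div]
    rw [this, div_le_iff₀ h4]
    linarith
  rw [hslice] at key
  have h2 := (abs_sub_le_iff.1 key).2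
  linarith

end Summit.PneNP.PneNP.Theorems.SliceACZero.Negative

end
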